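import Summits.QuantumFields.YangMills.Theorems.BalabanUVNodesN07ChartTopBoxPlaquettes
import Summits.QuantumFields.YangMills.Theorems.BalabanUVNodesN07SplitClauseLevelRaisingMarginWide
import Summits.QuantumFields.YangMills.Theorems.BalabanUVNodesN07RecordDomainsAdm22
import Literature.MathematicalPhysics.QuantumFieldTheory.Balaban1983to89.Node00.TorusCoverCollarOfMeetsPrintBox
import Literature.MathematicalPhysics.QuantumFieldTheory.Balaban1983to89.Node00.TorusCoverGaugeTokensR
import Literature.MathematicalPhysics.QuantumFieldTheory.Balaban1983to89.Node00.LargeFieldBackgroundCoPOfRecord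
import HarnessLib

/-!
# N07 [B11] (= [15] = [Balaban1985Variational]) Sect. F — THE CHART's LETTER `δ̂` SUPPLIED AT THE RECORD (OUTWARD-MEET-EDITION-SPEC §10 (C1a)): at a MEETING, PRINT-MARGIN-CLEAN datum of
# the token's run, «(7) for V» holds on the WHOLE chart top box — `PlaqSmallOn (boxPlaqs (sqLo_j − 1) (sqHi_j + 1)) ((1 + 2C_L)·δ_j) (M^j U)`, `δ̂` δ-LINEAR — from the token's own hypotheses
# (the fibre `AgreeOn`, the data's (7) `DataSmall7PTop`) and the run's letters (separation, grid saturation, the knit's floor)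

Cell `pub-ymgap`, seat `pub-ymgap-dag-n07-e` g24 (FAN-OUT §N07 row s3; LANE OWNER of the K0 road), MODULE 69b.  `--kind proof --supports stmt-QuantumFields-20541 --as helper` (K0⁷);
count-neutral; def-free.  [15] = [Balaban1985Variational]; [3] = [Balaban1985Averaging]; [6] = [Balaban1985RegularSpaces]; [III] = [Balaban1988Convergent].

WHAT THIS CLOSES BY NAME.  MODULE 62 (`…N07NormalisationTopRows.NrmOfRecord.norm_mlog_shearedAvgIter_top_le`, p660006) gives the chart's TOP rows `‖log 𝒜_j(U^u)(c)‖ ≤ 2(d−1)nδ̂` modulo ONE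
displayed letter `hV : PlaqSmallOn (boxPlaqs (sqLo L (cornerP idx) ρ j j − 1) (sqHi L (cornerP idx) (sideP) ρ j j + 1)) δ̂ (Averaging.iter (avOfRecord F N K) j U)` — «(7) for V» on the
chart's whole top box ([15] p. 303 «Now we use the assumption (7) for V, hence for V′»).  THIS FILE supplies `hV` with `δ̂ := (1 + 2·C_L)·δ_j`,
`C_L = (L² + 6((d+2)L)²)·(4(d−1)(2L−1) + 1)`, at every datum `(j, idx)`, `1 ≤ j ≤ k`, of a separated run `s` whose print box MEETS `Ω_j` (within `3`) and is PRINT-MARGIN-CLEAN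
(`j = k ∨` «□̃ = the `2ρ`-widened print box carries no point of `Ω_{j+1}`», the premise of the knit of record MODULE 67a), from: the fibre `AgreeOn (genSet s.Ω k) (M˙U) W`, the data's (7)
`Sect2.DataSmall7PTop (avOfRecord) s.Ω (suppDomOfRecord) k δ W`, the token's ranges `0 < δ_n ≤ a₁`, `δ_n ≤ 2δ_{n+1}`, the run's grid saturation (`dCubeSide … ∣ N₀`, as in the knit's `hgrid`),
the knit's floor `(11d + 4ρ + Mc)·L + 3 ≤ ν.M₁`, `1 ≤ ρ`, the level room `j + 1 ≤ m + K`, and ONE smallness guard on `a₁` (MODULE 68's `δ_N`-guard).  HOW: MODULE 69a part 2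
`plaqSmallOn_boxPlaqs_iter_succ` at `m = j − 1`, `δ₁ = δ_j`, `a = δ_{j−1} ≤ 2δ_j`, with its three geometric clauses DISCHARGED here: (i) margin — the unit boxes of the chart-box labels lie in the
chart box ⊆ «□̃» (MODULE 66 `chartTopBox_subset_wboxPrint`), which misses `Ω_{j+1}` by the premise (`s.Ω (k+1) = ∅` at the top, `Seq.Ω_off`); (ii) collar (`j ≥ 2`) — every point of «□̃»
is within `2ρ·Lʲ` of the print box (36a `exists_mem_box_within_of_mem_tcube_of_corner` via MODULE 66 `wbox_two_mul_eq_tcube`), hence projects into `Ω_{j−1}`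
(`TorusCoverCollarOfMeetsPrintBox.Sect2.cover_mem_Ω_pred_of_near_box_propCubeP_box` at `E = 2ρ`); (iii) support (`j = 1`) — the same points are within `ν.M₁` of the meeting site, hence in
`hullD ν.M₁ 1 (Ω 1) = suppDomOfRecord` (`TorusCoverGaugeTokensR.cover_mem_hullD_one_of_within`); block saturation of `Ω_j` from `N07RecordDomainsAdm22.blockSat_seqOfRecord`.

WHAT IS PROVED (sorry-free; no definition; axioms standard; by-name composition — NOTHING of [15]∕[3]∕[6] analysis beyond MODULE 68's crude Prop. 1).
§1 `unitBox_subset_chartBox` · `exists_mem_box_within_of_mem_chartBox` · `two_mul_L_lt_sitesPerDir`; §2 ★★★ `plaqSmallOn_chartTopBox_iter_of_data` (the letter `hV` of MODULE 62 at the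
record, `δ̂ = (1 + 2C_L)·δ_j`).

HONEST SCOPE.  Count-neutral; the fibre, the data's (7), the ranges and the run's letters are HYPOTHESES (the token's ∕ the knit's own binders — nothing new is assumed about Bałaban's
analysis); the crude constant `C_L` is MODULE 68's; the DENT near rows (LOCATED-DENT-ROWS ∕ LOCATED-THIRD-BLOCK) and the COLLAR far rows (LOCATED-COLLAR-ROWS) of SPEC §10 are NOT here;
HS3NORM ∕ HCHART-MEET-NORM ∕ HBUDGET-NORM stay displayed in the knit; K0⁷ ∕ K1⁹ NOT closed; N07 NOT discharged; counts unmoved (typed 28∕28 · discharged 5∕27); one finite 𝕋⁴ programme at fixed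
ε — the route closes the conditional finite-𝕋⁴ rung `BalabanLadder.UV` ONLY; the YM mass gap (Clay) is NOT proved by any of this; nothing continuum ∕ ℝ⁴ ∕ OS.  No `sorry`, no `def`, no
`instance`, no `notation`.

References: [15] (7) p. 278 L20–33, (13) p. 280, (144) p. 300, (147) p. 301, (160) p. 303; [3] Prop. 1 (51) pp. 25–26; [6] p. 98, (1.3)–(1.6) p. 77; [III] p. 255, (2.2) p. 255,
(2.10)–(2.11), (2.13) p. 256.
-/

set_option autoImplicit false

noncomputable section
open scoped BigOperators Matrix.Norms.L2Operator

namespace Summit.QuantumFields.YangMills.BalabanUVNodes.N07ChartTopBoxDataSmall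

open Literature.MathematicalPhysics.QuantumFieldTheory.Balaban1983to89
open Literature.MathematicalPhysics.QuantumFieldTheory.Balaban1983to89.Node00
open Literature.MathematicalPhysics.QuantumFieldTheory.Balaban1983to89.B15DeterminingSets
open T4Continuum (T4Family)
open T4AxialGaugeSmallField (castSite boxPlaqs)
open B15Eq112TorusCover (cover)
open B14DomainGeom (Pt Within)
open B8Eq131Cubes (box bLo bHi sqLo sqHi tcube)
open B5Eq118OneStroke (iterBlockOf)
open ExpMeanLog (deltaSU)
open Summit.QuantumFields.YangMills.BalabanUVNodes.N07ChartTopBoxPlaquettes (plaqSmallOn_boxPlaqs_iter_succ)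
open Summit.QuantumFields.YangMills.BalabanUVNodes.N07ChartTopBoxPlaquetteValues (mem_box_of_mem_unitBox)
open Summit.QuantumFields.YangMills.BalabanUVNodes.N07SplitClauseLevelRaisingMarginWide (chartTopBox_subset_wboxPrint wbox_two_mul_eq_tcube box_subset_wbox_width)
open Summit.QuantumFields.YangMills.BalabanUVNodes.N07RecordDomainsAdm22 (blockSat_seqOfRecord)

/-! ## §1  Geometry of the chart's top box: unit boxes, the clamp to the print box, the torus room -/

section Geometry

variable {P : Params}

/-- The unit box of a label of the chart's top box `[sqLo_j − 1, sqHi_j + 1]` (= the print box widened by `ρ + 1` blocks, `sqLo L c ρ j j = c − ρ`) lies in the `(ρ+1)`-widened print box.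
[cite: Balaban1985Variational, (144) p.300, (147) p.301 (bookkeeping); Balaban1985RegularSpaces, p.98] -/
theorem unitBox_subset_chartBox (c : Pt P.d) (S ρ j : ℕ) {t : Pt P.d}
    (ht : t ∈ Set.Icc (sqLo P.L c ρ j j - 1) (sqHi P.L c S ρ j j + 1)) :
    box P.L t 1 j ⊆ box P.L (c - ((ρ + 1 : ℕ) : Pt P.d)) (S + 2 * (ρ + 1)) j := by
  have hcorner : (c - ((ρ + 1 : ℕ) : Pt P.d)) = sqLo P.L c ρ j j - 1 := by
    funext i
    simp only [sqLo, bLo, Nat.sub_self, B8Eq131Cubes.gs_zero, pow_zero, one_mul, mul_one, Pi.sub_apply, Pi.natCast_apply, Pi.one_apply]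
    push_cast; ring
  intro z hz
  rw [hcorner]
  refine mem_box_of_mem_unitBox ht (fun i => ?_) hz
  simp only [sqLo, sqHi, bLo, bHi, Nat.sub_self, B8Eq131Cubes.gs_zero, pow_zero, one_mul, mul_one, Pi.sub_apply, Pi.add_apply, Pi.one_apply]
  push_cast; linarith

/-- **THE CLAMP**: every point of the unit box of a chart-box label is within `2ρ·Lʲ` of a point of the print box (`1 ≤ ρ`, `1 ≤ S`): chart box ⊆ «□̃» (MODULE 66) and 36a's clamp for `tcube`.
[cite: Balaban1985Variational, (144) p.300; Balaban1985RegularSpaces, p.98] -/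
theorem exists_mem_box_within_of_mem_chartBox (c : Pt P.d) {S ρ : ℕ} (hS : 1 ≤ S) (hρ : 1 ≤ ρ) (j : ℕ) {t : Pt P.d}
    (ht : t ∈ Set.Icc (sqLo P.L c ρ j j - 1) (sqHi P.L c S ρ j j + 1)) {z : Pt P.d} (hz : z ∈ box P.L t 1 j) :
    ∃ y ∈ box P.L c S j, Within (((2 * ρ * P.L ^ j : ℕ) : ℤ)) z y := by
  have hz' : z ∈ tcube P.L c S ρ j := by
    rw [← wbox_two_mul_eq_tcube]
    exact chartTopBox_subset_wboxPrint P.L c S j hρ (unitBox_subset_chartBox c S ρ j ht hz)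
  exact exists_mem_box_within_of_mem_tcube_of_corner (Nat.one_le_iff_ne_zero.mpr (by have := P.hL.2; omega)) hS
    (fun i => by push_cast; linarith) (fun i => by push_cast; linarith) j hz'

/-- The torus has room: `2L < N_m` whenever `m + 2 ≤ P.m + P.K` (`N_m = 2·L^{m+K−m} ≥ 2L²`). [cite: Balaban1987RG1, (0.1) p.251 (bookkeeping)] -/
theorem two_mul_L_lt_sitesPerDir {m : ℕ} (hm : m + 2 ≤ P.m + P.K) : 2 * P.L < P.sitesPerDir m := by
  unfold Params.sitesPerDir
  have hL : 2 ≤ P.L := P.hL.2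
  obtain ⟨r, hr⟩ : ∃ r, P.m + P.K - m = r + 2 := ⟨P.m + P.K - m - 2, by omega⟩
  rw [hr, pow_add, pow_two]
  have h1 : 1 ≤ P.L ^ r := Nat.one_le_pow _ _ (by omega)
  nlinarith

end Geometry

/-! ## §2  The letter `δ̂` at a meeting, print-margin-clean datum of the run -/

section Record

variable (F : T4Family) (N : ℕ) [NeZero N]

/-- ★★★ **«(7) FOR V» ON THE CHART's WHOLE TOP BOX, AT THE RECORD** — MODULE 62's displayed letter `hV` with `δ̂ = (1 + 2C_L)·δ_j`: for a separated run `s` (`Sect2.SeqSeparated ν.M₁ s`) with grid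
saturation, the knit's floor `(11d + 4ρ + Mc)·L + 3 ≤ ν.M₁`, `1 ≤ ρ`, `1 ≤ Mc`, level room `j + 1 ≤ m + K`, the token's ranges (`0 < δ_n ≤ a₁`, `δ_n ≤ 2δ_{n+1}`) and the guard
`(((d+2)L)²∕4)·((4(d−1)(2L−1)+1)·a₁) < δ_N`; data `W` with (7) for the support of record and a field `U` on the fibre; at every datum `(j, idx)`, `1 ≤ j ≤ k`, whose print box meets `Ω_j`
within `3` and is PRINT-MARGIN-CLEAN (`j = k ∨` the `2ρ`-widened print box misses `Ω_{j+1}`): every level-`j` plaquette of `M^j U` based in the chart's top box `[sqLo_j − 1, sqHi_j + 1]` is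
`< (1 + 2C_L)·δ_j`, `C_L = (L² + 6((d+2)L)²)·(4(d−1)(2L−1) + 1)`.
[cite: Balaban1985Variational, (7) p.278 L20–33, (13) p.280, (144) p.300, (147) p.301, (160) p.303; Balaban1985Averaging, Prop. 1 (51) pp.25–26; Balaban1988Convergent, p.255, (2.2), (2.10)–(2.13) pp.255–257] -/
theorem plaqSmallOn_chartTopBox_iter_of_data {ν : Stage7Numerics} {M : ℕ} {g : ℕ → ℝ} {K k : ℕ} (s : SeqOfRecord F ν M g K k)
    (hsep : Sect2.SeqSeparated ν.M₁ s) (hkK : k ≤ (F.P K).m + (F.P K).K)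
    (hgrid : ∀ j : ℕ, 1 ≤ j → j ≤ k → dCubeSide (F.P K).L M (RkOfRecord (F.P K).L ν.r (g j)) j ∣ (F.P K).sitesPerDir 0)
    {Mc ρ : ℕ} (hMc : 1 ≤ Mc) (hρ : 1 ≤ ρ) (hfloor : (11 * (F.P K).d + 4 * ρ + Mc) * (F.P K).L + 3 ≤ ν.M₁)
    {δ : ℕ → ℝ} {a₁ : ℝ} (hδ : ∀ n, n ≤ k → 0 < δ n ∧ δ n ≤ a₁) (hcompδ : ∀ n, n < k → δ n ≤ 2 * δ (n + 1))
    (hguard : (((((F.P K).d + 2) * (F.P K).L : ℕ) : ℝ) ^ 2 / 4) * ((4 * (((((F.P K).d - 1 : ℕ) : ℝ)) * ((2 * (F.P K).L - 1 : ℕ) : ℝ)) + 1) * a₁) < deltaSU (Fin N))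
    (W : MSField (F.P K) (SU N)) (h7 : Sect2.DataSmall7PTop (avOfRecord F N K) s.Ω (suppDomOfRecord F ν K s.Ω) k δ W)
    (U : GaugeField (F.P K) 0 (SU N)) (hfib : AgreeOn (genSet s.Ω k) (avgFamily (avOfRecord F N K) U) W)
    {j : ℕ} (hj1 : 1 ≤ j) (hjk : j ≤ k) (hjK : j + 1 ≤ (F.P K).m + (F.P K).K) (idx : Pt (F.P K).d)
    (hmeet : ∃ x ∈ box (F.P K).L (cornerP (F.P K) Mc ρ idx) (sideP (F.P K) Mc ρ) j, ∃ y : Pt (F.P K).d, cover (F.P K) y ∈ s.Ω j ∧ Within ((3 : ℕ) : ℤ) x y)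
    (hclean : j = k ∨ ∀ z ∈ box (F.P K).L (cornerP (F.P K) Mc ρ idx - ((2 * ρ : ℕ) : Pt (F.P K).d)) (sideP (F.P K) Mc ρ + 2 * (2 * ρ)) j, cover (F.P K) z ∉ s.Ω (j + 1)) :
    PlaqSmallOn (boxPlaqs (sqLo (F.P K).L (cornerP (F.P K) Mc ρ idx) ρ j j - 1) (sqHi (F.P K).L (cornerP (F.P K) Mc ρ idx) (sideP (F.P K) Mc ρ) ρ j j + 1))
      ((1 + 2 * ((((F.P K).L : ℝ) ^ 2 + 6 * ((((F.P K).d + 2) * (F.P K).L : ℕ) : ℝ) ^ 2) * (4 * (((((F.P K).d - 1 : ℕ) : ℝ)) * ((2 * (F.P K).L - 1 : ℕ) : ℝ)) + 1))) * δ j)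
      (Averaging.iter (avOfRecord F N K) j U) := by
  -- write `j = m + 1`
  obtain ⟨m, rfl⟩ : ∃ m, j = m + 1 := ⟨j - 1, by omega⟩
  set c : Pt (F.P K).d := cornerP (F.P K) Mc ρ idx with hc
  set S : ℕ := sideP (F.P K) Mc ρ with hS
  set CL : ℝ := (((F.P K).L : ℝ) ^ 2 + 6 * ((((F.P K).d + 2) * (F.P K).L : ℕ) : ℝ) ^ 2) * (4 * (((((F.P K).d - 1 : ℕ) : ℝ)) * ((2 * (F.P K).L - 1 : ℕ) : ℝ)) + 1) with hCL
  have hCL0 : 0 ≤ CL := by positivity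
  have hν0 : 0 < ν.M₁ := by omega
  have hν1 : 1 ≤ ν.M₁ := hν0
  have hρ0 : 0 < ρ := hρ
  have hS1 : 1 ≤ S := by have := le_sideP (P := F.P K) Mc hρ0; omega
  -- the letters of MODULE 69a: `δ₁ = δ_{m+1}`, `a = δ_m ≤ a₁`
  have hδm : 0 < δ m := (hδ m (by omega)).1
  have hδm1 : δ m ≤ a₁ := (hδ m (by omega)).2
  have hδj : 0 ≤ δ (m + 1) := (hδ (m + 1) hjk).1.le
  have hguard' : (((((F.P K).d + 2) * (F.P K).L : ℕ) : ℝ) ^ 2 / 4) * ((4 * (((((F.P K).d - 1 : ℕ) : ℝ)) * ((2 * (F.P K).L - 1 : ℕ) : ℝ)) + 1) * δ m) < deltaSU (Fin N) := by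
    refine lt_of_le_of_lt ?_ hguard
    gcongr
  have hN : 2 * (F.P K).L < (F.P K).sitesPerDir m := two_mul_L_lt_sitesPerDir (by omega)
  -- block saturation of `Ω_{m+1}` (grid numerics)
  have hsat : ∀ x x' : Site (F.P K) 0, iterBlockOf (m + 1) x = iterBlockOf (m + 1) x' → x ∈ s.Ω (m + 1) → x' ∈ s.Ω (m + 1) :=
    fun x x' => blockSat_seqOfRecord F ν M g K k hkK s hgrid (m + 1) x x' hj1 hjk
  -- the data's clauses
  have h7succ := h7.2 m hjk
  have h7m : ∀ m', m' + 1 = m → PlaqSmallOn (Sect2.printedPlaqs s.Ω k (m' + 1)) (δ m)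
      (Sect2.mixedField (avOfRecord F N K) (genSet s.Ω k (m' + 1)) (W (m' + 1)) (W m')) := by
    intro m' hm'
    subst hm'
    exact h7.2 m' (by omega)
  have h70 : m = 0 → PlaqSmallOn (Sect2.printedPlaqsTop s.Ω (suppDomOfRecord F ν K s.Ω) k) (δ m) (W 0) := by
    intro h0; subst h0; exact h7.1
  -- (i) MARGIN: the unit boxes of the chart-box labels miss `Ω_{m+2}` (chart box ⊆ □̃, print-margin-clean; at the top `Ω_{k+1} = ∅`)
  have hfar : ∀ t ∈ Set.Icc (sqLo (F.P K).L c ρ (m + 1) (m + 1) - 1) (sqHi (F.P K).L c S ρ (m + 1) (m + 1) + 1),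
      ∀ z ∈ box (F.P K).L t 1 (m + 1), cover (F.P K) z ∉ s.Ω (m + 2) := by
    intro t ht z hz
    rcases hclean with htop | hcl
    · rw [s.Ω_off (m + 2) (by omega)]; exact Set.notMem_empty _
    · exact hcl z (chartTopBox_subset_wboxPrint (F.P K).L c S (m + 1) hρ (unitBox_subset_chartBox c S ρ (m + 1) ht hz))
  -- (ii) COLLAR (`m ≥ 1`): every such point projects into `Ω_m` (within `2ρ·L^{m+1}` of the print box; 57a at `E = 2ρ`)
  obtain ⟨x₀, hx₀, y₀, hy₀, hxy₀⟩ := hmeet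
  have hcol : 1 ≤ m → ∀ t ∈ Set.Icc (sqLo (F.P K).L c ρ (m + 1) (m + 1) - 1) (sqHi (F.P K).L c S ρ (m + 1) (m + 1) + 1),
      ∀ z ∈ box (F.P K).L t 1 (m + 1), cover (F.P K) z ∈ s.Ω m := by
    intro h1 t ht z hz
    obtain ⟨y', hy', hzy'⟩ := exists_mem_box_within_of_mem_chartBox c hS1 hρ (m + 1) ht hz
    have hfl : 11 * (F.P K).d + 2 * ρ + Mc + 3 + 2 * ρ ≤ ν.M₁ := by
      have hL1 : 1 ≤ (F.P K).L := (F.P K).L_pos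
      have : 11 * (F.P K).d + 4 * ρ + Mc ≤ (11 * (F.P K).d + 4 * ρ + Mc) * (F.P K).L := Nat.le_mul_of_pos_right _ hL1
      omega
    have h := Sect2.cover_mem_Ω_pred_of_near_box_propCubeP_box (P := F.P K) hν1 s hsep (Dw := 3) (E := 2 * ρ) hfl (n := m + 1) (by omega) hjk hx₀ hy₀ hxy₀
      (z := z) (y' := y') hy' (by simpa [mul_comm, mul_assoc] using hzy')
    simpa using h
  -- (iii) SUPPORT (`m = 0`): every such point lies within `ν.M₁` of the meeting site, hence in `hullD ν.M₁ 1 (Ω 1)`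
  have hsupp : m = 0 → ∀ t ∈ Set.Icc (sqLo (F.P K).L c ρ (m + 1) (m + 1) - 1) (sqHi (F.P K).L c S ρ (m + 1) (m + 1) + 1),
      ∀ z ∈ box (F.P K).L t 1 (m + 1), cover (F.P K) z ∈ suppDomOfRecord F ν K s.Ω := by
    intro h0 t ht z hz
    subst h0
    obtain ⟨y', hy', hzy'⟩ := exists_mem_box_within_of_mem_chartBox c hS1 hρ (0 + 1) ht hz
    have hbox := within_of_mem_box_of_mem_box (F.P K).L hy' hx₀
    have hw := (hzy'.triangle hbox).triangle hxy₀
    rw [suppDomOfRecord_eq]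
    refine cover_mem_hullD_one_of_within hν0 hy₀ (hw.mono ?_)
    have hSle : (S : ℤ) ≤ Mc + 11 * (F.P K).d + 2 * ρ := by exact_mod_cast sideP_le (P := F.P K) Mc ρ
    have hf : (((11 * (F.P K).d + 4 * ρ + Mc) * (F.P K).L + 3 : ℕ) : ℤ) ≤ ν.M₁ := by exact_mod_cast hfloor
    push_cast at hf ⊢
    have hL0 : (0 : ℤ) ≤ (F.P K).L := by positivity
    nlinarith
  -- MODULE 69a part 2, then `δ_m ≤ 2δ_{m+1}`
  have hmain := plaqSmallOn_boxPlaqs_iter_succ F N K s.Ω W U hjk (by omega) hfib hsat hδj hδm hN hguard' h7succ h7m h70 hfar hcol hsupp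
  intro p hp
  refine (hmain p hp).trans_le ?_
  have h2 : δ m ≤ 2 * δ (m + 1) := hcompδ m (by omega)
  have hAB : (((F.P K).L : ℝ) ^ 2 + 6 * ((((F.P K).d + 2) * (F.P K).L : ℕ) : ℝ) ^ 2) *
      ((4 * (((((F.P K).d - 1 : ℕ) : ℝ)) * ((2 * (F.P K).L - 1 : ℕ) : ℝ)) + 1) * δ m) = CL * δ m := by rw [hCL]; ring
  rw [hAB]
  nlinarith [mul_le_mul_of_nonneg_left h2 hCL0]

end Record

end Summit.QuantumFields.YangMills.BalabanUVNodes.N07ChartTopBoxDataSmall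

end
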